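import Mathlib.Analysis.Complex.TaylorSeries
import Mathlib.Analysis.Complex.Liouville
import Mathlib.Analysis.Complex.LocallyUniformLimit
import Mathlib.Topology.MetricSpace.ProperSpace.Lemmas
import HarnessLib

/-!
# N15 (NE2) King-model rung, PART 28c — AN ELEMENTARY VITALI THEOREM ON A DISC: uniformly bounded holomorphic functions that
# converge along a real segment converge locally uniformly to a holomorphic limit

Tenth generation (g10) of the seat `pub-ymgap-dag-n15-d`, part 28c: the GENERIC complex-analysis step between part 28b (holomorphy of every
level `z ↦ C^{(k)}_z(x,y)` of the complex-dressed King covariances, with the `k`-UNIFORM bound `2∕γ₀` on one disc) and part 28d (holomorphy of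
their `k → ∞` limit).  Part 10e gives the limit only at REAL couplings; the passage «uniformly bounded + convergent on a set with an
accumulation point ⇒ locally uniformly convergent» is Vitali's theorem (Vitali 1903 ∕ Porter 1904; Montel's normal families), which Mathlib
does not have (it has `TendstoLocallyUniformlyOn.differentiableOn` for the limit once local uniform convergence is known).  This file proves
the disc case from the centre by an ELEMENTARY Taylor-coefficient argument (no Arzelà–Ascoli, no Montel):

* §1 Taylor coefficients `tcoeff g n = iteratedDeriv n g 0 ∕ n!` of a function holomorphic on `ball 0 R`: the series sums to `g`
  (`Complex.hasSum_taylorSeries_on_ball`), Cauchy's estimate `‖tcoeff g n‖ ≤ C∕rⁿ` for `‖g‖ ≤ C`, `0 < r < R`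
  (`Complex.norm_iteratedDeriv_le_of_forall_mem_sphere_norm_le`), and the geometric tail bound
  `‖g z − Σ_{m<N} tcoeff g m·z^m‖ ≤ C·(‖z‖∕r)^N∕(1 − ‖z‖∕r)`;
* §2 ★ `tendsto_tcoeff` — THE INDUCTION: if `f_k` are holomorphic on `ball 0 R`, `‖f_k‖ ≤ C` there, and `(f_k t)_k` converges for every real
  `0 < t < ρ`, then EVERY Taylor coefficient converges, `tcoeff (f_k) n → limCoeff f n` (strong induction on `n`: at order `n` divide the
  order-`n` Taylor remainder at a small real `t` by `tⁿ`; the tail costs `2C·t∕r^{n+1}`, the head converges by the induction hypothesis; Cauchy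
  criterion in ℂ);
* §3 the limit `vitaliLim f z = Σ' limCoeff f n·zⁿ`, `‖limCoeff f n‖ ≤ C∕rⁿ`, and ★ `tendstoUniformlyOn_vitaliLim`: `f_k → vitaliLim f` UNIFORMLY on
  every closed disc `‖z‖ ≤ r' < R`;
* §4 ★★ `vitali_disc`: `vitaliLim f` is HOLOMORPHIC on `ball 0 R`, `f_k → vitaliLim f` locally uniformly and pointwise on the ball, and
  ★ `vitali_disc_deriv`: the derivatives converge locally uniformly too (`TendstoLocallyUniformlyOn.deriv`); the limit inherits the bound
  (`norm_vitaliLim_le`) and hence ★ CAUCHY'S ESTIMATES `‖(vitaliLim f)^{(n)}(z₀)‖ ≤ n!·C∕rⁿ` (`norm_iteratedDeriv_vitaliLim_le`).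

References (method): G. Vitali, *Sopra le serie di funzioni analitiche*, Rend. R. Ist. Lombardo (2) 36 (1903) 772–774; E. C. Titchmarsh,
*The Theory of Functions*, 2nd ed. (Oxford 1939) §5.21; R. Remmert, *Classical Topics in Complex Function Theory* (Springer 1998) §7.3.
[folklore].

HONEST SCOPE.  One-variable complex analysis over Mathlib; the disc is centred at the accumulation point `0` of the real segment (the general
Vitali–Porter theorem — any domain, any set with a limit point — is NOT proved here); nothing is specific to King or Bałaban; NOT a node discharge;
count-neutral.  No `sorry`, standard axioms, default heartbeats.
-/

noncomputable section

open Filter Topology Metric Finset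
open scoped BigOperators

namespace Summit.QuantumFields.YangMills.BalabanUVNodes.N15.KingModel

/-! ## §1 Taylor coefficients of a bounded holomorphic function on a disc -/

section Taylor

variable {g : ℂ → ℂ} {R C r : ℝ}

/-- The `n`-th Taylor coefficient at the origin, `g^{(n)}(0)∕n!`. [folklore] -/
def tcoeff (g : ℂ → ℂ) (n : ℕ) : ℂ := ((n.factorial : ℂ))⁻¹ * iteratedDeriv n g 0

/-- **Taylor's theorem on the disc**: for `g` holomorphic on `ball 0 R` and `‖z‖ < R`, `Σ_n tcoeff g n·zⁿ = g z`. [folklore] -/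
theorem hasSum_tcoeff (hg : DifferentiableOn ℂ g (ball 0 R)) {z : ℂ} (hz : z ∈ ball 0 R) :
    HasSum (fun n => tcoeff g n * z ^ n) (g z) := by
  refine (Complex.hasSum_taylorSeries_on_ball hg hz).congr_fun fun n => ?_
  simp only [sub_zero, smul_eq_mul, tcoeff]
  ring

/-- **Cauchy's estimate for the coefficients**: `‖g‖ ≤ C` on `ball 0 R` and `0 < r < R` give `‖tcoeff g n‖ ≤ C∕rⁿ`. [folklore] -/
theorem norm_tcoeff_le (hg : DifferentiableOn ℂ g (ball 0 R)) (hb : ∀ z ∈ ball 0 R, ‖g z‖ ≤ C) (hr : 0 < r) (hrR : r < R) (n : ℕ) :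
    ‖tcoeff g n‖ ≤ C / r ^ n := by
  have hdc : DiffContOnCl ℂ g (ball 0 r) := by
    refine DifferentiableOn.diffContOnCl ?_
    rw [closure_ball (0 : ℂ) hr.ne']
    exact hg.mono (closedBall_subset_ball hrR)
  have h := Complex.norm_iteratedDeriv_le_of_forall_mem_sphere_norm_le n hr hdc
    (fun z hz => hb z (closedBall_subset_ball hrR (sphere_subset_closedBall hz)))
  have hn : (0 : ℝ) < n.factorial := by exact_mod_cast n.factorial_pos
  rw [tcoeff, norm_mul, norm_inv, Complex.norm_natCast]
  calc (n.factorial : ℝ)⁻¹ * ‖iteratedDeriv n g 0‖ ≤ (n.factorial : ℝ)⁻¹ * (n.factorial * C / r ^ n) :=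
        mul_le_mul_of_nonneg_left h (inv_nonneg.mpr hn.le)
    _ = C / r ^ n := by field_simp

/-- The bound forces `C ≥ 0` (the disc is non-empty). [folklore] -/
theorem bound_nonneg (hb : ∀ z ∈ ball 0 R, ‖g z‖ ≤ C) (hR : 0 < R) : 0 ≤ C :=
  (norm_nonneg _).trans (hb 0 (mem_ball_self hR))

/-- **The geometric tail of the Taylor series**: for `‖g‖ ≤ C` on `ball 0 R`, `0 < r < R` and `‖z‖ < r`,
`‖g z − Σ_{m<N} tcoeff g m·z^m‖ ≤ C·(‖z‖∕r)^N·(1 − ‖z‖∕r)⁻¹`. [folklore] -/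
theorem norm_sub_taylor_partial_le (hg : DifferentiableOn ℂ g (ball 0 R)) (hb : ∀ z ∈ ball 0 R, ‖g z‖ ≤ C) (hr : 0 < r) (hrR : r < R)
    {z : ℂ} (hz : ‖z‖ < r) (N : ℕ) :
    ‖g z - ∑ m ∈ range N, tcoeff g m * z ^ m‖ ≤ C * (‖z‖ / r) ^ N * (1 - ‖z‖ / r)⁻¹ := by
  have hC : 0 ≤ C := bound_nonneg hb (hr.trans hrR)
  have hzR : z ∈ ball 0 R := by rw [mem_ball_zero_iff]; linarith
  have htail := (hasSum_nat_add_iff' N).mpr (hasSum_tcoeff hg hzR)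
  rw [← htail.tsum_eq]
  set q : ℝ := ‖z‖ / r with hq
  have hq0 : 0 ≤ q := div_nonneg (norm_nonneg z) hr.le
  have hq1 : q < 1 := (div_lt_one hr).mpr hz
  have hgeo : HasSum (fun m : ℕ => C * q ^ (m + N)) (C * q ^ N * (1 - q)⁻¹) := by
    have h := (hasSum_geometric_of_lt_one hq0 hq1).mul_left (C * q ^ N)
    refine (h.congr_fun fun m => ?_).trans_eq ?_ <;> ring_nf
  refine tsum_of_norm_bounded hgeo fun m => ?_
  rw [norm_mul, norm_pow]
  calc ‖tcoeff g (m + N)‖ * ‖z‖ ^ (m + N) ≤ C / r ^ (m + N) * ‖z‖ ^ (m + N) :=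
      mul_le_mul_of_nonneg_right (norm_tcoeff_le hg hb hr hrR _) (pow_nonneg (norm_nonneg z) _)
    _ = C * q ^ (m + N) := by rw [hq, div_pow]; field_simp

end Taylor

/-! ## §2 The induction: every Taylor coefficient converges -/

section Vitali

variable {f : ℕ → ℂ → ℂ} {R C ρ : ℝ}

/-- The candidate limit coefficients (`limUnder`; identified as the limits by `tendsto_tcoeff`). [folklore] -/
def limCoeff (f : ℕ → ℂ → ℂ) (n : ℕ) : ℂ := limUnder atTop (fun k => tcoeff (f k) n)

/-- The order-`n` algebra at a point: `tcoeff g n = t^{−n}·(g t − Σ_{m<n} tcoeff g m·t^m) − t^{−n}·(g t − Σ_{m<n+1} tcoeff g m·t^m)`. [folklore] -/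
theorem tcoeff_eq_head_sub_tail (g : ℂ → ℂ) {t : ℂ} (ht : t ≠ 0) (n : ℕ) :
    tcoeff g n = (t ^ n)⁻¹ * (g t - ∑ m ∈ range n, tcoeff g m * t ^ m) - (t ^ n)⁻¹ * (g t - ∑ m ∈ range (n + 1), tcoeff g m * t ^ m) := by
  rw [sum_range_succ]
  field_simp
  ring

/-- A norm inequality used below: `‖a − b + c‖ ≤ ‖a‖ + ‖b‖ + ‖c‖`. [folklore] -/
theorem norm_sub_add_le_three (a b c : ℂ) : ‖a - b + c‖ ≤ ‖a‖ + ‖b‖ + ‖c‖ := by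
  calc ‖a - b + c‖ ≤ ‖a - b‖ + ‖c‖ := norm_add_le _ _
    _ ≤ ‖a‖ + ‖b‖ + ‖c‖ := by have := norm_sub_le a b; linarith

/-- ★ **EVERY TAYLOR COEFFICIENT CONVERGES** (the core of Vitali's theorem on the disc): if the `f_k` are holomorphic on `ball 0 R` with
`‖f_k‖ ≤ C` there and `(f_k t)_k` converges for every real `0 < t < ρ`, then `tcoeff (f_k) n → limCoeff f n` for every `n`. [folklore] -/
theorem tendsto_tcoeff (hR : 0 < R) (hρ : 0 < ρ) (hd : ∀ k, DifferentiableOn ℂ (f k) (ball 0 R)) (hb : ∀ k, ∀ z ∈ ball 0 R, ‖f k z‖ ≤ C)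
    (hconv : ∀ t : ℝ, 0 < t → t < ρ → ∃ l : ℂ, Tendsto (fun k => f k (t : ℂ)) atTop (𝓝 l)) (n : ℕ) :
    Tendsto (fun k => tcoeff (f k) n) atTop (𝓝 (limCoeff f n)) := by
  induction n using Nat.strong_induction_on with
  | _ n ih =>
  have hC : 0 ≤ C := bound_nonneg (hb 0) hR
  apply tendsto_nhds_limUnder
  apply cauchySeq_tendsto_of_complete
  rw [Metric.cauchySeq_iff]
  intro ε hε
  -- the coefficient radius `r = R/2` and a small real point `t`
  set r : ℝ := R / 2 with hr
  have hr0 : 0 < r := by positivity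
  have hrR : r < R := by rw [hr]; linarith
  obtain ⟨t, ht0, htρ, htr, htε⟩ : ∃ t : ℝ, 0 < t ∧ t < ρ ∧ t ≤ r / 2 ∧ 4 * C * t / r ^ (n + 1) ≤ ε / 4 := by
    refine ⟨min (min (ρ / 2) (r / 2)) (ε / 4 * r ^ (n + 1) / (4 * C + 1)), ?_, ?_, ?_, ?_⟩
    · positivity
    · exact lt_of_le_of_lt ((min_le_left _ _).trans (min_le_left _ _)) (by linarith)
    · exact (min_le_left _ _).trans (min_le_right _ _)
    · have h1 : min (min (ρ / 2) (r / 2)) (ε / 4 * r ^ (n + 1) / (4 * C + 1)) ≤ ε / 4 * r ^ (n + 1) / (4 * C + 1) := min_le_right _ _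
      have hrp : 0 < r ^ (n + 1) := pow_pos hr0 _
      rw [div_le_iff₀ hrp]
      calc 4 * C * min (min (ρ / 2) (r / 2)) (ε / 4 * r ^ (n + 1) / (4 * C + 1))
          ≤ 4 * C * (ε / 4 * r ^ (n + 1) / (4 * C + 1)) := mul_le_mul_of_nonneg_left h1 (by positivity)
        _ = (4 * C / (4 * C + 1)) * (ε / 4 * r ^ (n + 1)) := by ring
        _ ≤ 1 * (ε / 4 * r ^ (n + 1)) :=
            mul_le_mul_of_nonneg_right ((div_le_one (by positivity)).mpr (by linarith)) (by positivity)
        _ = ε / 4 * r ^ (n + 1) := one_mul _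
  have htC : (t : ℂ) ≠ 0 := by exact_mod_cast ht0.ne'
  have htn : ‖((t : ℂ) ^ n)⁻¹‖ = (t ^ n)⁻¹ := by
    rw [norm_inv, norm_pow, Complex.norm_real, Real.norm_eq_abs, abs_of_pos ht0]
  -- the head sequence `u_k = t^{-n}(f_k t − Σ_{m<n} a_{m,k} t^m)` converges, hence is Cauchy
  obtain ⟨l, hl⟩ := hconv t ht0 htρ
  have hu : Tendsto (fun k => ((t : ℂ) ^ n)⁻¹ * (f k t - ∑ m ∈ range n, tcoeff (f k) m * (t : ℂ) ^ m)) atTop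
      (𝓝 (((t : ℂ) ^ n)⁻¹ * (l - ∑ m ∈ range n, limCoeff f m * (t : ℂ) ^ m))) := by
    refine Tendsto.const_mul _ (hl.sub ?_)
    exact tendsto_finsetSum _ fun m hm => (ih m (mem_range.mp hm)).mul_const _
  obtain ⟨K, hK⟩ := Metric.cauchySeq_iff.mp hu.cauchySeq (ε / 2) (by positivity)
  refine ⟨K, fun k hk k' hk' => ?_⟩
  -- tails at order n+1 cost `2C (t/r)^{n+1}` each
  have htail : ∀ j, ‖((t : ℂ) ^ n)⁻¹ * (f j t - ∑ m ∈ range (n + 1), tcoeff (f j) m * (t : ℂ) ^ m)‖ ≤ 2 * C * t / r ^ (n + 1) := by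
    intro j
    have htlt : ‖(t : ℂ)‖ < r := by rw [Complex.norm_real, Real.norm_eq_abs, abs_of_pos ht0]; linarith
    have h1 := norm_sub_taylor_partial_le (hd j) (hb j) hr0 hrR htlt (n + 1)
    rw [Complex.norm_real, Real.norm_eq_abs, abs_of_pos ht0] at h1
    have hq : t / r ≤ 1 / 2 := by rw [div_le_iff₀ hr0]; linarith
    have hq' : (1 - t / r)⁻¹ ≤ 2 := by
      rw [inv_le_comm₀ (by linarith) two_pos]; linarith
    rw [norm_mul, htn]
    calc (t ^ n)⁻¹ * ‖f j ↑t - ∑ m ∈ range (n + 1), tcoeff (f j) m * (t : ℂ) ^ m‖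
        ≤ (t ^ n)⁻¹ * (C * (t / r) ^ (n + 1) * (1 - t / r)⁻¹) := mul_le_mul_of_nonneg_left h1 (by positivity)
      _ ≤ (t ^ n)⁻¹ * (C * (t / r) ^ (n + 1) * 2) := by gcongr
      _ = 2 * C * t / r ^ (n + 1) := by rw [div_pow]; field_simp; ring
  have hhead := hK k hk k' hk'
  rw [dist_eq_norm] at hhead ⊢
  rw [tcoeff_eq_head_sub_tail (f k) htC n, tcoeff_eq_head_sub_tail (f k') htC n]
  calc ‖((t : ℂ) ^ n)⁻¹ * (f k t - ∑ m ∈ range n, tcoeff (f k) m * (t : ℂ) ^ m)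
          - ((t : ℂ) ^ n)⁻¹ * (f k t - ∑ m ∈ range (n + 1), tcoeff (f k) m * (t : ℂ) ^ m)
          - (((t : ℂ) ^ n)⁻¹ * (f k' t - ∑ m ∈ range n, tcoeff (f k') m * (t : ℂ) ^ m)
              - ((t : ℂ) ^ n)⁻¹ * (f k' t - ∑ m ∈ range (n + 1), tcoeff (f k') m * (t : ℂ) ^ m))‖
      = ‖(((t : ℂ) ^ n)⁻¹ * (f k t - ∑ m ∈ range n, tcoeff (f k) m * (t : ℂ) ^ m)
            - ((t : ℂ) ^ n)⁻¹ * (f k' t - ∑ m ∈ range n, tcoeff (f k') m * (t : ℂ) ^ m))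
          - ((t : ℂ) ^ n)⁻¹ * (f k t - ∑ m ∈ range (n + 1), tcoeff (f k) m * (t : ℂ) ^ m)
          + ((t : ℂ) ^ n)⁻¹ * (f k' t - ∑ m ∈ range (n + 1), tcoeff (f k') m * (t : ℂ) ^ m)‖ := by ring_nf
    _ ≤ ‖((t : ℂ) ^ n)⁻¹ * (f k t - ∑ m ∈ range n, tcoeff (f k) m * (t : ℂ) ^ m)
            - ((t : ℂ) ^ n)⁻¹ * (f k' t - ∑ m ∈ range n, tcoeff (f k') m * (t : ℂ) ^ m)‖
          + ‖((t : ℂ) ^ n)⁻¹ * (f k t - ∑ m ∈ range (n + 1), tcoeff (f k) m * (t : ℂ) ^ m)‖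
          + ‖((t : ℂ) ^ n)⁻¹ * (f k' t - ∑ m ∈ range (n + 1), tcoeff (f k') m * (t : ℂ) ^ m)‖ := norm_sub_add_le_three _ _ _
    _ < ε / 2 + 2 * C * t / r ^ (n + 1) + 2 * C * t / r ^ (n + 1) := by
        have := htail k; have := htail k'; linarith
    _ ≤ ε := by
        have : 2 * C * t / r ^ (n + 1) + 2 * C * t / r ^ (n + 1) = 4 * C * t / r ^ (n + 1) := by ring
        linarith

/-! ## §3 The limit function and uniform convergence on closed discs -/

/-- **The Vitali limit** `F z = Σ' limCoeff f n·zⁿ`. [folklore] -/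
def vitaliLim (f : ℕ → ℂ → ℂ) (z : ℂ) : ℂ := ∑' n, limCoeff f n * z ^ n

/-- The limit coefficients obey Cauchy's estimate: `‖limCoeff f n‖ ≤ C∕rⁿ` for `0 < r < R`. [folklore] -/
theorem norm_limCoeff_le (hR : 0 < R) (hρ : 0 < ρ) (hd : ∀ k, DifferentiableOn ℂ (f k) (ball 0 R))
    (hb : ∀ k, ∀ z ∈ ball 0 R, ‖f k z‖ ≤ C) (hconv : ∀ t : ℝ, 0 < t → t < ρ → ∃ l : ℂ, Tendsto (fun k => f k (t : ℂ)) atTop (𝓝 l))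
    {r : ℝ} (hr : 0 < r) (hrR : r < R) (n : ℕ) : ‖limCoeff f n‖ ≤ C / r ^ n :=
  le_of_tendsto (tendsto_tcoeff hR hρ hd hb hconv n).norm (Eventually.of_forall fun k => norm_tcoeff_le (hd k) (hb k) hr hrR n)

/-- The limit series converges absolutely on the disc: for `‖z‖ < R`, `HasSum (limCoeff f n·zⁿ) (vitaliLim f z)`. [folklore] -/
theorem hasSum_vitaliLim (hR : 0 < R) (hρ : 0 < ρ) (hd : ∀ k, DifferentiableOn ℂ (f k) (ball 0 R))
    (hb : ∀ k, ∀ z ∈ ball 0 R, ‖f k z‖ ≤ C) (hconv : ∀ t : ℝ, 0 < t → t < ρ → ∃ l : ℂ, Tendsto (fun k => f k (t : ℂ)) atTop (𝓝 l))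
    {z : ℂ} (hz : ‖z‖ < R) : HasSum (fun n => limCoeff f n * z ^ n) (vitaliLim f z) := by
  have hC : 0 ≤ C := bound_nonneg (hb 0) hR
  obtain ⟨r, hzr, hrR⟩ := exists_between hz
  have hr : 0 < r := lt_of_le_of_lt (norm_nonneg z) hzr
  have hq0 : 0 ≤ ‖z‖ / r := div_nonneg (norm_nonneg z) hr.le
  have hq1 : ‖z‖ / r < 1 := (div_lt_one hr).mpr hzr
  have hsum : Summable (fun n => limCoeff f n * z ^ n) := by
    refine Summable.of_norm_bounded ((summable_geometric_of_lt_one hq0 hq1).mul_left C) fun n => ?_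
    rw [norm_mul, norm_pow]
    calc ‖limCoeff f n‖ * ‖z‖ ^ n ≤ C / r ^ n * ‖z‖ ^ n :=
        mul_le_mul_of_nonneg_right (norm_limCoeff_le hR hρ hd hb hconv hr hrR n) (pow_nonneg (norm_nonneg z) _)
      _ = C * (‖z‖ / r) ^ n := by rw [div_pow]; field_simp
  exact hsum.hasSum

/-- ★ **UNIFORM CONVERGENCE ON EVERY CLOSED DISC INSIDE**: for `0 < r' < R`, `f_k → vitaliLim f` uniformly on `closedBall 0 r'`. [folklore] -/
theorem tendstoUniformlyOn_vitaliLim (hR : 0 < R) (hρ : 0 < ρ) (hd : ∀ k, DifferentiableOn ℂ (f k) (ball 0 R))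
    (hb : ∀ k, ∀ z ∈ ball 0 R, ‖f k z‖ ≤ C) (hconv : ∀ t : ℝ, 0 < t → t < ρ → ∃ l : ℂ, Tendsto (fun k => f k (t : ℂ)) atTop (𝓝 l))
    {r' : ℝ} (hr' : 0 < r') (hr'R : r' < R) : TendstoUniformlyOn f (vitaliLim f) atTop (closedBall 0 r') := by
  have hC : 0 ≤ C := bound_nonneg (hb 0) hR
  -- a coefficient radius strictly between `r'` and `R`
  set r : ℝ := (r' + R) / 2 with hrdef
  have hr'r : r' < r := by rw [hrdef]; linarith
  have hrR : r < R := by rw [hrdef]; linarith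
  have hr : 0 < r := hr'.trans hr'r
  clear_value r
  set q : ℝ := r' / r with hqdef
  have hq0 : 0 ≤ q := div_nonneg hr'.le hr.le
  have hq1 : q < 1 := (div_lt_one hr).mpr hr'r
  clear_value q
  rw [Metric.tendstoUniformlyOn_iff]
  intro ε hε
  -- the tail: choose `N` with `2C q^N/(1−q) < ε/2`
  have htail0 : Tendsto (fun N : ℕ => 2 * C * (1 - q)⁻¹ * q ^ N) atTop (𝓝 (2 * C * (1 - q)⁻¹ * 0)) :=
    (tendsto_pow_atTop_nhds_zero_of_lt_one hq0 hq1).const_mul _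
  rw [mul_zero] at htail0
  obtain ⟨N, hN⟩ := (htail0.eventually (gt_mem_nhds (half_pos hε))).exists
  -- the head: finitely many coefficients converge
  have hhead : Tendsto (fun k => ∑ m ∈ range N, ‖tcoeff (f k) m - limCoeff f m‖ * r' ^ m) atTop (𝓝 0) := by
    have h : Tendsto (fun k => ∑ m ∈ range N, ‖tcoeff (f k) m - limCoeff f m‖ * r' ^ m) atTop
        (𝓝 (∑ m ∈ range N, ‖limCoeff f m - limCoeff f m‖ * r' ^ m)) :=
      tendsto_finsetSum _ fun m _ => ((tendsto_tcoeff hR hρ hd hb hconv m).sub_const _).norm.mul_const _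
    simpa using h
  filter_upwards [hhead.eventually (gt_mem_nhds (half_pos hε))] with k hk z hz
  have hzr' : ‖z‖ ≤ r' := mem_closedBall_zero_iff.mp hz
  have hzr : ‖z‖ < r := lt_of_le_of_lt hzr' hr'r
  have hzR : ‖z‖ < R := hzr.trans hrR
  -- the difference series
  have hdiff : HasSum (fun m => (tcoeff (f k) m - limCoeff f m) * z ^ m) (f k z - vitaliLim f z) := by
    have h := (hasSum_tcoeff (hd k) (mem_ball_zero_iff.mpr hzR)).sub (hasSum_vitaliLim hR hρ hd hb hconv hzR)
    refine h.congr_fun fun m => ?_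
    ring
  have hsplit := (hasSum_nat_add_iff' N).mpr hdiff
  -- tail bound
  have hgeo : HasSum (fun m : ℕ => 2 * C * q ^ (m + N)) (2 * C * q ^ N * (1 - q)⁻¹) := by
    have h := (hasSum_geometric_of_lt_one hq0 hq1).mul_left (2 * C * q ^ N)
    refine (h.congr_fun fun m => ?_).trans_eq ?_ <;> ring_nf
  have htail : ‖f k z - vitaliLim f z - ∑ m ∈ range N, (tcoeff (f k) m - limCoeff f m) * z ^ m‖ ≤ 2 * C * q ^ N * (1 - q)⁻¹ := by
    rw [← hsplit.tsum_eq]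
    refine tsum_of_norm_bounded hgeo fun m => ?_
    rw [norm_mul, norm_pow]
    have h1 : ‖tcoeff (f k) (m + N) - limCoeff f (m + N)‖ ≤ 2 * C / r ^ (m + N) := by
      calc ‖tcoeff (f k) (m + N) - limCoeff f (m + N)‖ ≤ ‖tcoeff (f k) (m + N)‖ + ‖limCoeff f (m + N)‖ := norm_sub_le _ _
        _ ≤ C / r ^ (m + N) + C / r ^ (m + N) :=
            add_le_add (norm_tcoeff_le (hd k) (hb k) hr hrR _) (norm_limCoeff_le hR hρ hd hb hconv hr hrR _)
        _ = 2 * C / r ^ (m + N) := by ring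
    calc ‖tcoeff (f k) (m + N) - limCoeff f (m + N)‖ * ‖z‖ ^ (m + N) ≤ 2 * C / r ^ (m + N) * r' ^ (m + N) :=
          mul_le_mul h1 (pow_le_pow_left₀ (norm_nonneg z) hzr' _) (pow_nonneg (norm_nonneg z) _) (by positivity)
      _ = 2 * C * q ^ (m + N) := by rw [hqdef, div_pow, div_mul_eq_mul_div, mul_div_assoc]
  -- head bound
  have hheadz : ‖∑ m ∈ range N, (tcoeff (f k) m - limCoeff f m) * z ^ m‖ ≤ ∑ m ∈ range N, ‖tcoeff (f k) m - limCoeff f m‖ * r' ^ m := by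
    refine (norm_sum_le _ _).trans (sum_le_sum fun m _ => ?_)
    rw [norm_mul, norm_pow]
    exact mul_le_mul_of_nonneg_left (pow_le_pow_left₀ (norm_nonneg z) hzr' _) (norm_nonneg _)
  rw [dist_comm, dist_eq_norm]
  calc ‖f k z - vitaliLim f z‖
      = ‖(f k z - vitaliLim f z - ∑ m ∈ range N, (tcoeff (f k) m - limCoeff f m) * z ^ m)
          + ∑ m ∈ range N, (tcoeff (f k) m - limCoeff f m) * z ^ m‖ := by rw [sub_add_cancel]
    _ ≤ 2 * C * q ^ N * (1 - q)⁻¹ + ∑ m ∈ range N, ‖tcoeff (f k) m - limCoeff f m‖ * r' ^ m :=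
        (norm_add_le _ _).trans (add_le_add htail hheadz)
    _ < ε / 2 + ε / 2 := by
        have h1 : 2 * C * q ^ N * (1 - q)⁻¹ = 2 * C * (1 - q)⁻¹ * q ^ N := by ring
        rw [h1]
        exact add_lt_add hN hk
    _ = ε := by ring

/-! ## §4 Vitali's theorem on the disc -/

/-- ★★ **VITALI'S THEOREM ON A DISC (elementary form)**: if `f_k : ℂ → ℂ` are holomorphic on `ball 0 R` (`R > 0`), uniformly bounded there
(`‖f_k z‖ ≤ C`), and `(f_k t)_k` converges for every real `0 < t < ρ` (`ρ > 0`), then there is a function `F = vitaliLim f`, HOLOMORPHIC on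
`ball 0 R`, with `f_k → F` LOCALLY UNIFORMLY on the ball (hence pointwise at every point of the ball). [folklore] -/
theorem vitali_disc (hR : 0 < R) (hρ : 0 < ρ) (hd : ∀ k, DifferentiableOn ℂ (f k) (ball 0 R)) (hb : ∀ k, ∀ z ∈ ball 0 R, ‖f k z‖ ≤ C)
    (hconv : ∀ t : ℝ, 0 < t → t < ρ → ∃ l : ℂ, Tendsto (fun k => f k (t : ℂ)) atTop (𝓝 l)) :
    DifferentiableOn ℂ (vitaliLim f) (ball 0 R) ∧ TendstoLocallyUniformlyOn f (vitaliLim f) atTop (ball 0 R) ∧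
      ∀ z ∈ ball 0 R, Tendsto (fun k => f k z) atTop (𝓝 (vitaliLim f z)) := by
  have hloc : TendstoLocallyUniformlyOn f (vitaliLim f) atTop (ball 0 R) := by
    rw [tendstoLocallyUniformlyOn_iff_forall_isCompact isOpen_ball]
    intro K hK hKc
    obtain ⟨r₀, hr₀R, hKr₀⟩ := exists_lt_subset_ball hKc.isClosed hK
    set r' := max r₀ (R / 2) with hr'
    have hr'0 : 0 < r' := lt_of_lt_of_le (half_pos hR) (le_max_right _ _)
    have hr'R : r' < R := max_lt hr₀R (by linarith)
    have hK' : K ⊆ closedBall 0 r' := hKr₀.trans ((ball_subset_ball (le_max_left _ _)).trans ball_subset_closedBall)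
    exact (tendstoUniformlyOn_vitaliLim hR hρ hd hb hconv hr'0 hr'R).mono hK'
  refine ⟨hloc.differentiableOn (Eventually.of_forall hd) isOpen_ball, hloc, fun z hz => hloc.tendsto_at hz⟩

/-- ★ **… AND THE DERIVATIVES CONVERGE**: under the hypotheses of `vitali_disc`, `deriv (f_k) → deriv (vitaliLim f)` locally uniformly on
the ball (Weierstrass; Mathlib's `TendstoLocallyUniformlyOn.deriv`). [folklore] -/
theorem vitali_disc_deriv (hR : 0 < R) (hρ : 0 < ρ) (hd : ∀ k, DifferentiableOn ℂ (f k) (ball 0 R)) (hb : ∀ k, ∀ z ∈ ball 0 R, ‖f k z‖ ≤ C)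
    (hconv : ∀ t : ℝ, 0 < t → t < ρ → ∃ l : ℂ, Tendsto (fun k => f k (t : ℂ)) atTop (𝓝 l)) :
    TendstoLocallyUniformlyOn (fun k => deriv (f k)) (deriv (vitaliLim f)) atTop (ball 0 R) ∧
      ∀ z ∈ ball 0 R, Tendsto (fun k => deriv (f k) z) atTop (𝓝 (deriv (vitaliLim f) z)) := by
  have h := ((vitali_disc hR hρ hd hb hconv).2.1).deriv (Eventually.of_forall hd) isOpen_ball
  exact ⟨h, fun z hz => h.tendsto_at hz⟩

/-- **On the real segment the Vitali limit is the given limit**: if `f_k t → l` for a real `0 < t < min ρ R`, then `vitaliLim f t = l`. [folklore] -/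
theorem vitaliLim_eq_of_tendsto (hR : 0 < R) (hρ : 0 < ρ) (hd : ∀ k, DifferentiableOn ℂ (f k) (ball 0 R))
    (hb : ∀ k, ∀ z ∈ ball 0 R, ‖f k z‖ ≤ C) (hconv : ∀ t : ℝ, 0 < t → t < ρ → ∃ l : ℂ, Tendsto (fun k => f k (t : ℂ)) atTop (𝓝 l))
    {z : ℂ} (hz : z ∈ ball 0 R) {l : ℂ} (hl : Tendsto (fun k => f k z) atTop (𝓝 l)) : vitaliLim f z = l :=
  tendsto_nhds_unique ((vitali_disc hR hρ hd hb hconv).2.2 z hz) hl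

/-- **The Vitali limit inherits the bound**: `‖vitaliLim f z‖ ≤ C` on the ball. [folklore] -/
theorem norm_vitaliLim_le (hR : 0 < R) (hρ : 0 < ρ) (hd : ∀ k, DifferentiableOn ℂ (f k) (ball 0 R)) (hb : ∀ k, ∀ z ∈ ball 0 R, ‖f k z‖ ≤ C)
    (hconv : ∀ t : ℝ, 0 < t → t < ρ → ∃ l : ℂ, Tendsto (fun k => f k (t : ℂ)) atTop (𝓝 l)) {z : ℂ} (hz : z ∈ ball 0 R) :
    ‖vitaliLim f z‖ ≤ C :=
  le_of_tendsto ((vitali_disc hR hρ hd hb hconv).2.2 z hz).norm (Eventually.of_forall fun k => hb k z hz)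

/-- ★ **CAUCHY'S ESTIMATES PASS TO THE LIMIT**: for every closed disc `closedBall z₀ r ⊆ ball 0 R` (`r > 0`) and every order `n`,
`‖(vitaliLim f)^{(n)}(z₀)‖ ≤ n!·C∕rⁿ`. [folklore] -/
theorem norm_iteratedDeriv_vitaliLim_le (hR : 0 < R) (hρ : 0 < ρ) (hd : ∀ k, DifferentiableOn ℂ (f k) (ball 0 R))
    (hb : ∀ k, ∀ z ∈ ball 0 R, ‖f k z‖ ≤ C) (hconv : ∀ t : ℝ, 0 < t → t < ρ → ∃ l : ℂ, Tendsto (fun k => f k (t : ℂ)) atTop (𝓝 l))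
    {z₀ : ℂ} {r : ℝ} (hr : 0 < r) (hsub : closedBall z₀ r ⊆ ball 0 R) (n : ℕ) :
    ‖iteratedDeriv n (vitaliLim f) z₀‖ ≤ n.factorial * C / r ^ n := by
  have hV := vitali_disc hR hρ hd hb hconv
  have hdc : DiffContOnCl ℂ (vitaliLim f) (ball z₀ r) := by
    refine DifferentiableOn.diffContOnCl ?_
    rw [closure_ball z₀ hr.ne']
    exact hV.1.mono hsub
  exact Complex.norm_iteratedDeriv_le_of_forall_mem_sphere_norm_le n hr hdc
    fun z hz => norm_vitaliLim_le hR hρ hd hb hconv (hsub (sphere_subset_closedBall hz))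

end Vitali

end Summit.QuantumFields.YangMills.BalabanUVNodes.N15.KingModel

end
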